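import Literature.NumberTheory.EllipticCurves.NonsingularReductionEmbedding
import Summits.BirchSwinnertonDyer.Rank1Residual.X11b.NeronIdentityReceptacleKodairaNeron
import HarnessLib

/-!
# T1 JET (cell `bsd-jet`), road K — G-rec: the receptacle `E⁰(K̄_v) = X11b.E0Receptacle (W⁄K) v`
# read on the model `W` itself, and `E⁰`-membership of points of `E(L)` (`L ⊂ K̄_v` a number field)
# as nonsingular reduction at the place cut out by the embedding

HONEST FRAMING (programme file §HONESTY, verbatim): «no tranche here proves BSD; ARM L moves the
LITERAL column of an r ≤ 1 census into the kernel-proved-modulo-named-print column.» THEOREMS ONLY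
(seat `bsd-jet-ty` g8); 0 classes move; kernel plumbing for the BY-NAME discharge of the END FORMs'
cite-only schema `hGZ` from the Literature fact `Gross1991_heegnerPoint_sub_ratTorsion_mem_E0`
(reader-1 ADD-8 §B(e) / ANNEX-5 §2: «replace it BY NAME by the Literature fact + the G-rec
transport»).

WHAT. `X11b.E0Receptacle W v ≤ E(K̄_v)` (x11b3) is the pull-back of "nonsingular reduction" along
THREE chosen witnesses: the spectral valuation `|·|_v` of `K̄_v`, a structure map
`ι₀ : 𝓞_v → 𝒪_{|·|_v}`, and a change of variables `C₀` over `K_v` to the chosen local minimal model.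
The Literature fact speaks of `E₀(K[n])_w` on the model `W` at a place `w` of the ring class field
(`placeIntModel`). This file removes the witnesses:
* `mem_E0Receptacle_some_iff_reducesToNonsingular[_choose]` — if `W ⊗ K_v` is ITSELF minimal over
  `𝓞_v`, then `(x, y) ∈ E0Receptacle W v ↔ (x, y)` reduces to a nonsingular point OF `W` for
  `|·|_v` (`ReducesToNonsingular`): by Silverman VII.1.3(b) (tree
  `exists_variableChange_integralModel_eq`) `C₀` comes from an `𝓞_v`-integral `(u, r, s, t)`,
  `u ∈ 𝓞_v^×`, and such changes preserve `E₀`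
  (`hasNonsingularReduction_variableChange_some_iff`);
* `mem_E0Receptacle_some_iff_hasNonsingularReduction_placeIntModel` — **G-rec**: for `W/ℚ` with
  integer coefficients, `(W ⊗ K) ⊗ K_v` minimal, a number field `L` with a ring homomorphism
  `e : L → K̄_v` and the place `w` of `L` cut out by `e` (`exists_heightOneSpectrum_isEquiv_comap`):
  `(e x, e y) ∈ E0Receptacle (W ⊗ K) v ↔ (x, y) ∈ E₀(L)_w` on `placeIntModel W L w`
  (`reducesToNonsingular_some_iff_hasNonsingularReduction_intModel`).
Statements take the receptacle element as a variable `Q` with `Q = .some x y h` (the receptacle's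
ambient type `localPoints` is a type synonym), so that consumers rewrite at `instances` transparency.

References: [cite: SilvermanAEC2009, VII.1 Prop. 1.3(b) (PDF p. 165), VII.§2 (`E₀`, PDF pp. 166–167)]
[cite: GrossLMS1991, §6, proof of Prop. 6.2 (1), p. 245] [cite: GrossZagier1986, III (3.1)].

presearch (D-0021): `lean search 'E0Receptacle'` → x11b3's `mem_E0Receptacle_iff[_reducesToNonsingular]`,
`E0Receptacle_transport_*`, the Kodaira–Néron exponents, and consumers; no point-from-a-subfield
form (the Literature fact's docstring records it as "kernel plumbing for the consumer … not done here").
-/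

noncomputable section

open scoped NNReal
open NumberField IsDedekindDomain WeierstrassCurve

namespace Summit.BirchSwinnertonDyer.Rank1Residual.JET

open scoped Classical
open Literature.NumberTheory.EllipticCurves Literature.NumberTheory.GaloisRepresentations
  IsDedekindDomain.HeightOneSpectrum Summit.BirchSwinnertonDyer.Rank1Residual.X11b

universe uK

variable {K : Type uK} [Field K] [NumberField K]

/-- **The receptacle `E⁰(K̄_v)` read on a minimal model** (coordinate form). If `W ⊗ K_v` is ITSELF
a minimal `𝓞_v`-equation, then a point `(x, y) ∈ E(K̄_v)` lies in `X11b.E0Receptacle W v` iff it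
reduces to a nonsingular point of `W` for the (chosen) spectral valuation `|·|_v`
(`ReducesToNonsingular`): the receptacle's transport to the chosen local minimal model
`M = W.localMinimalIntegralModel v` is, by Silverman VII.1.3(b) (tree
`exists_variableChange_integralModel_eq`), an `𝓞_v`-integral change of variables `(u, r, s, t)`,
`u ∈ 𝓞_v^×`, which preserves `E₀` (`hasNonsingularReduction_variableChange_some_iff`).
[cite: SilvermanAEC2009, VII.1 Prop. 1.3(b) (PDF p. 165), VII.§2 (PDF p. 166)] -/
theorem mem_E0Receptacle_some_iff_reducesToNonsingular_choose (W : WeierstrassCurve K) [W.IsElliptic]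
    (v : HeightOneSpectrum (𝓞 K))
    (hmin : (W.baseChange (v.adicCompletion K)).IsMinimal (v.adicCompletionIntegers K))
    {x y : AlgebraicClosure (v.adicCompletion K)}
    (h : (W.baseChange (AlgebraicClosure (v.adicCompletion K))).toAffine.Nonsingular x y)
    {Q : localPoints W (v.adicCompletion K)} (hQ : Q = .some x y h) :
    Q ∈ E0Receptacle W v ↔
      ReducesToNonsingular (v.exists_spectralValuation).choose
        (IsLocalRing.residue (v.exists_spectralValuation).choose.integer)
        (.some x y h : (W.baseChange (AlgebraicClosure (v.adicCompletion K))).toAffine.Point) := by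
  subst hQ
  haveI := hmin
  haveI := W.isMinimal_map_localMinimalIntegralModel (v := v)
  -- names for the chosen data
  set w := (v.exists_spectralValuation).choose with hwdef
  have hw : ∀ z, (w z : ℝ) = spectralNorm (v.adicCompletion K) (AlgebraicClosure (v.adicCompletion K)) z :=
    (v.exists_spectralValuation).choose_spec
  set C₀ := (W.exists_variableChange_eq_localMinimalIntegralModel v).choose with hC₀def
  have hC₀ : C₀ • W.baseChange (v.adicCompletion K) = (W.localMinimalIntegralModel v).map
      (algebraMap (v.adicCompletionIntegers K) (v.adicCompletion K)) :=
    (W.exists_variableChange_eq_localMinimalIntegralModel v).choose_spec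
  set ι₀ := (exists_ringHom_adicCompletionIntegers_integer (v.exists_spectralValuation).choose_spec).choose
    with hι₀def
  have hι : ∀ a, ((ι₀ a : w.integer) : AlgebraicClosure (v.adicCompletion K)) =
      algebraMap (v.adicCompletion K) (AlgebraicClosure (v.adicCompletion K)) (a : v.adicCompletion K) :=
    (exists_ringHom_adicCompletionIntegers_integer (v.exists_spectralValuation).choose_spec).choose_spec
  -- the receptacle, unfolded, and the transported coordinates
  rw [X11b.mem_E0Receptacle_iff]
  simp only [Affine.Point.congrEquiv_some, VariableChange.pointEquivBaseChange_some]
  -- VII.1.3(b): the chosen change of variables is `𝓞_v`-integral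
  have hΔ : (W.baseChange (v.adicCompletion K)).Δ ≠ 0 := (W.baseChange (v.adicCompletion K)).isUnit_Δ.ne_zero
  obtain ⟨D', hD', hint⟩ := exists_variableChange_integralModel_eq (v.adicCompletionIntegers K) hC₀.symm hΔ
  rw [X11b.integralModel_map_localMinimalIntegralModel_eq] at hint
  set X₀ := integralModel (v.adicCompletionIntegers K) (W.baseChange (v.adicCompletion K)) with hX₀def
  -- the two `𝒪_w`-models differ by the integral change of variables `D'`
  have hV : (D'.map ι₀) • (X₀.map ι₀) = (W.localMinimalIntegralModel v).map ι₀ := by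
    rw [hint, map_variableChange]
  have hDC : (D'.map ι₀).map (algebraMap w.integer (AlgebraicClosure (v.adicCompletion K))) =
      C₀.map (algebraMap (v.adicCompletion K) (AlgebraicClosure (v.adicCompletion K))) := by
    rw [VariableChange.map_map, ← hD', VariableChange.map_map]
    congr 1
    exact RingHom.ext fun a ↦ hι a
  have hX : (X₀.map ι₀).baseChange (AlgebraicClosure (v.adicCompletion K)) =
      W.baseChange (AlgebraicClosure (v.adicCompletion K)) := by
    rw [← X11b.baseChange_map_eq_baseChange_map_choose v X₀,
      show X₀.map (algebraMap (v.adicCompletionIntegers K) (v.adicCompletion K)) =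
        X₀.baseChange (v.adicCompletion K) from rfl,
      hX₀def, baseChange_integralModel_eq, baseChange_baseChange_adicCompletion]
  have h₄ : ((X₀.map ι₀).baseChange (AlgebraicClosure (v.adicCompletion K))).toAffine.Nonsingular x y := by
    rw [hX]; exact h
  have hx' : (C₀.map (algebraMap (v.adicCompletion K) (AlgebraicClosure (v.adicCompletion K)))).toX x =
      ((D'.map ι₀).map (algebraMap w.integer (AlgebraicClosure (v.adicCompletion K)))).toX x := by
    rw [hDC]
  have hy' : (C₀.map (algebraMap (v.adicCompletion K) (AlgebraicClosure (v.adicCompletion K)))).toY x y =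
      ((D'.map ι₀).map (algebraMap w.integer (AlgebraicClosure (v.adicCompletion K)))).toY x y := by
    rw [hDC]
  rw [hasNonsingularReduction_variableChange_some_iff (X₀.map ι₀) (D'.map ι₀) hV hx' hy' h₄,
    ← reducesToNonsingular_iff_hasNonsingularReduction (X₀.map ι₀),
    ← reducesToNonsingular_congrEquiv_iff (IsLocalRing.residue _) hX (.some x y h₄),
    Affine.Point.congrEquiv_some]

/-- The same for ANY valuation `w₀` presenting the spectral norm (all such coincide).
[cite: SilvermanAEC2009, VII.1 Prop. 1.3(b), VII.§2] -/
theorem mem_E0Receptacle_some_iff_reducesToNonsingular (W : WeierstrassCurve K) [W.IsElliptic]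
    (v : HeightOneSpectrum (𝓞 K)) {w₀ : Valuation (AlgebraicClosure (v.adicCompletion K)) ℝ≥0}
    (hw₀ : ∀ z, (w₀ z : ℝ) =
      spectralNorm (v.adicCompletion K) (AlgebraicClosure (v.adicCompletion K)) z)
    (hmin : (W.baseChange (v.adicCompletion K)).IsMinimal (v.adicCompletionIntegers K))
    {x y : AlgebraicClosure (v.adicCompletion K)}
    (h : (W.baseChange (AlgebraicClosure (v.adicCompletion K))).toAffine.Nonsingular x y)
    {Q : localPoints W (v.adicCompletion K)} (hQ : Q = .some x y h) :
    Q ∈ E0Receptacle W v ↔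
      ReducesToNonsingular w₀ (IsLocalRing.residue w₀.integer)
        (.some x y h : (W.baseChange (AlgebraicClosure (v.adicCompletion K))).toAffine.Point) := by
  have heq : w₀ = (v.exists_spectralValuation).choose :=
    Valuation.ext fun z ↦ NNReal.coe_injective
      (by rw [hw₀, (v.exists_spectralValuation).choose_spec])
  subst heq
  exact mem_E0Receptacle_some_iff_reducesToNonsingular_choose W v hmin h hQ

/-- Integers have spectral valuation `≤ 1` in `K̄_v`. [folklore] -/
theorem spectralValuation_intCast_le_one (v : HeightOneSpectrum (𝓞 K))
    {w₀ : Valuation (AlgebraicClosure (v.adicCompletion K)) ℝ≥0}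
    (hw₀ : ∀ z, (w₀ z : ℝ) =
      spectralNorm (v.adicCompletion K) (AlgebraicClosure (v.adicCompletion K)) z) (m : ℤ) :
    w₀ (m : AlgebraicClosure (v.adicCompletion K)) ≤ 1 := by
  rw [← map_intCast (algebraMap (v.adicCompletionIntegers K) (AlgebraicClosure (v.adicCompletion K))) m]
  exact (mem_localAbsIntegers_iff_spectralValuation hw₀).mp
    ((mem_integralClosure_iff _ _).mpr isIntegral_algebraMap)

/-- **G-rec: `E⁰(K̄_v)`-membership of a point of `E(L)`, `L` a number field embedded in `K̄_v`, is
nonsingular reduction at the place cut out by the embedding.** Let `W/ℚ` have integer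
coefficients, `K` a number field, `v` a finite place at which `(W ⊗ K) ⊗ K_v` is a minimal
`𝓞_v`-equation, `e : L → K̄_v` a ring homomorphism from a number field `L`, and `w` a finite place
of `L` equivalent to `|e ·|_v` (`exists_heightOneSpectrum_isEquiv_comap`). Then for
`(x, y) ∈ E(L) = W(L)`: `(e x, e y) ∈ X11b.E0Receptacle (W ⊗ K) v` iff `(x, y)` has nonsingular
reduction at `w` on the model `W` (`placeIntModel W L w`, the `E₀(L)_w` of
`Gross1991_heegnerPoint_sub_ratTorsion_mem_E0`). [cite: SilvermanAEC2009, VII.§2 (`E₀`), VII.1 Prop. 1.3(b)] -/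
theorem mem_E0Receptacle_some_iff_hasNonsingularReduction_placeIntModel (W : WeierstrassCurve ℚ)
    [W.IsIntegral ℤ] [W.IsElliptic] (v : HeightOneSpectrum (𝓞 K))
    {w₀ : Valuation (AlgebraicClosure (v.adicCompletion K)) ℝ≥0}
    (hw₀ : ∀ z, (w₀ z : ℝ) =
      spectralNorm (v.adicCompletion K) (AlgebraicClosure (v.adicCompletion K)) z)
    (hmin : ((W.baseChange K).baseChange (v.adicCompletion K)).IsMinimal (v.adicCompletionIntegers K))
    {L : Type} [Field L] [NumberField L] (e : L →+* AlgebraicClosure (v.adicCompletion K))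
    {w : HeightOneSpectrum (𝓞 L)} (hwe : (w.valuation L).IsEquiv (w₀.comap e)) {x y : L}
    (h : (W.baseChange L).toAffine.Nonsingular x y)
    (h' : ((W.baseChange K).baseChange (AlgebraicClosure (v.adicCompletion K))).toAffine.Nonsingular
      (e x) (e y)) {Q : localPoints (W.baseChange K) (v.adicCompletion K)} (hQ : Q = .some _ _ h') :
    Q ∈ E0Receptacle (W.baseChange K) v ↔
      (placeIntModel W L w).HasNonsingularReduction (K := L) (.some x y h) := by
  rw [mem_E0Receptacle_some_iff_reducesToNonsingular (W.baseChange K) v hw₀ hmin h' hQ]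
  exact reducesToNonsingular_some_iff_hasNonsingularReduction_intModel W
    (heightOneSpectrum_valuation_intCast_le_one L w) (spectralValuation_intCast_le_one v hw₀) e
    (fun z ↦ Valuation.isEquiv_iff_val_le_one.mp hwe) h h'

end Summit.BirchSwinnertonDyer.Rank1Residual.JET

end
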